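import Literature.Probability.RandomPlanarGeometry.HexSAWPolygonCellsOmegaClosedForm
import Literature.Probability.RandomPlanarGeometry.HexSAWPolygonCellsPeelStability
import HarnessLib

/-!
# Cell calculus for honeycomb polygon surgery, XXXV: OMEGA of a set minus a stick top = OMEGA minus the ray top

Topic `Literature/Probability/RandomPlanarGeometry` (lane «pcv-sawmu», a-p4 g22; sequel of XXXIII `…CellsOmegaClosedForm` (closed form of `omegaRec`) and
XXXIV `…CellsPeelStability` (`peel_erase_of_stickTop`)).

The one-step inversion used by CASE 1 of the decoder of THEOREM I (`HOME/pub-sawmu-a-p4/g21/omega/THEOREM-OMEGA-g21.md` §4: «X = W − w = ι(S⁻) where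
S⁻ := S minus the top cell of the stick over the same host»): for a stick top `c` of an admissible `S`,
* `omegaRec_port_erase_stickTop` — the ports of the other peeled hexagons do not change when `c` is removed (same base by peel stability, same sticks
  below, `omegaRec_port_urIter`);
* ★★ `omegaRec_image_erase_stickTop` — `(omegaRec C P₀ (S.erase c)).1 = (omegaRec C P₀ S).1.erase (LL (port c))`: the image loses exactly the top
  hexagon of the ray over `c`'s host (closed form + injectivity of the ray map + disjointness from the base image, XXXIII).

Sources: N. Madras, G. Slade, *The Self-Avoiding Walk* (1993), §3.2, proof of Theorem 3.2.3 [MadrasSlade1993]; I. Jensen, J. Phys.: Conf. Ser. 42 (2006) 163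
[Jensen2006HoneycombPolygons].  Label (lane): LANE INFRASTRUCTURE for the lane's step-two injection; nothing new in writing.
-/

open Finset

namespace Literature.Probability.RandomPlanarGeometry.SAW

namespace HexCell

variable {C : Finset Cell → Finset Cell} {P₀ : Finset Cell → Cell → Cell}

/-- ★ **Ports are stable under removing a stick top**: for `m ≠ c` peeled, the port of `m` in `S.erase c` equals its port in `S`.
[cite: MadrasSlade1993, §3.2 (proof of Theorem 3.2.3)] -/
theorem omegaRec_port_erase_stickTop {S : Finset Cell} (hS : IsBrickSet S) (h2 : 2 ≤ #(peel S)) {c : Cell}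
    (hc : c ∈ S \ peel S) (hur : UR c ∉ S) {m : Cell} (hm : m ∈ (S \ peel S).erase c) :
    (omegaRec C P₀ (S.erase c)).2 m = (omegaRec C P₀ S).2 m := by
  have hpeel := peel_erase_of_stickTop hS h2 hc hur
  have hsd := sdiff_peel_erase_of_stickTop hS h2 hc hur
  obtain ⟨hmc, hm'⟩ := mem_erase.1 hm
  obtain ⟨h, i, hhost, hi, hme, hst⟩ := exists_host_stick_of_mem_sdiff_peel hm'
  subst hme
  have hst' : ∀ j, 1 ≤ j → j ≤ i → urIter h j ∈ S.erase c \ peel (S.erase c) := by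
    intro j hj hji
    rw [hsd]
    refine mem_erase.2 ⟨fun e => ?_, hst j hj hji⟩
    by_cases hji' : j = i
    · subst hji'; exact hmc e
    · have hnext := hst (j + 1) (by omega) (by omega)
      apply hur
      rw [← e, ← urIter_succ]
      exact (mem_sdiff.1 hnext).1
  have hh : h ∉ S \ peel S := fun hh => (mem_sdiff.1 hh).2 hhost.1
  have hh' : h ∉ S.erase c \ peel (S.erase c) := by
    rw [hsd]; exact fun hh2 => hh (mem_of_mem_erase hh2)
  rw [omegaRec_port_urIter hh' i hst', omegaRec_port_urIter hh i hst, hpeel]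

/-- ★★ **OMEGA of `S` minus a stick top is OMEGA of `S` minus the corresponding ray top**: under the hypotheses of THEOREM V's recursion,
`(omegaRec C P₀ (S.erase c)).1 = (omegaRec C P₀ S).1.erase (LL ((omegaRec C P₀ S).2 c))`.
[cite: MadrasSlade1993, §3.2 (proof of Theorem 3.2.3: the surgery is undone spike by spike)] -/
theorem omegaRec_image_erase_stickTop {X S : Finset Cell} (hS : IsBrickSet S) (h2 : 2 ≤ #(peel S))
    (hX : ∀ c ∈ S \ peel S, LL c ∉ X) (hbase : PortInv X (peel S) (C (peel S)) (P₀ (peel S)))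
    {c : Cell} (hc : c ∈ S \ peel S) (hur : UR c ∉ S) :
    (omegaRec C P₀ (S.erase c)).1 = ((omegaRec C P₀ S).1).erase (LL ((omegaRec C P₀ S).2 c)) := by
  classical
  obtain ⟨hinj, hdisj⟩ := injOn_ray_and_disjoint (C := C) (P₀ := P₀) hS hX hbase
  have hpeel := peel_erase_of_stickTop hS h2 hc hur
  have hsd := sdiff_peel_erase_of_stickTop hS h2 hc hur
  have hport : ∀ m ∈ (S \ peel S).erase c, LL ((omegaRec C P₀ (S.erase c)).2 m) = LL ((omegaRec C P₀ S).2 m) := fun m hm => by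
    rw [omegaRec_port_erase_stickTop hS h2 hc hur hm]
  rw [omegaRec_image_eq (S.erase c), omegaRec_image_eq S, hsd, hpeel]
  ext x
  simp only [mem_union, mem_erase, mem_image]
  constructor
  · rintro (hx | ⟨m, hm, rfl⟩)
    · refine ⟨fun e => ?_, Or.inl hx⟩
      exact (disjoint_left.1 hdisj) hx (e ▸ mem_image_of_mem _ hc)
    · obtain ⟨hmc, hm'⟩ := hm
      rw [hport m (mem_erase.2 ⟨hmc, hm'⟩)]
      exact ⟨fun e => hmc (hinj (mem_coe.2 hm') (mem_coe.2 hc) e), Or.inr ⟨m, hm', rfl⟩⟩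
  · rintro ⟨hne, hx | ⟨m, hm', rfl⟩⟩
    · exact Or.inl hx
    · have hmc : m ≠ c := fun e => hne (by rw [e])
      exact Or.inr ⟨m, ⟨hmc, hm'⟩, hport m (mem_erase.2 ⟨hmc, hm'⟩)⟩

end HexCell

end Literature.Probability.RandomPlanarGeometry.SAW
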